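import Summits.NavierStokesRegularity.NavierStokesRegularity.Theorems.TypeICertificateLadderTargetFiveHalvesWindowAprioriDecay

/-!
# Crux `Target` (stmt-NavierStokesRegularity-1217), line `depletion-ladder` at `q = 5/2`: a-priori
# power rates under collapse Reynolds number `C` with a general `L^{5/2}` slab coefficient

`--supports stmt-NavierStokesRegularity-1217` (file 3 of the depleted `q = 5/2` chain).
`FiveHalvesWindow.aprioriDecay_of_rate` (slab coefficient `15/16`) with the coefficient replaced by
`5c/2` for a parameter `c ≥ 0` — the form delivered by the depleted slab `depletedSlab`
(`c ≥ (2κ²+1)/8` under the `q = 5/2` depletion law): along a classical Leray–Hopf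
rapidly-decaying-datum solution with eventual rate `√(T−t)‖u(t,x)‖ ≤ C√ν`,
`∫F(curl u(t)) ≤ K₁(T−t)^{-5cC²/2}`, `∫|∇u(t)|² ≤ K₂(T−t)^{-C²/2}`, `‖u(t,x)‖² ≤ M/(T−t)` on `(0,T)`
(`aprioriDecay_of_rate_coeff`, hypotheses-as-functions form). [folklore: Grönwall bookkeeping]
-/

noncomputable section

open Set Filter Topology MeasureTheory
open scoped RealInnerProductSpace ENNReal NNReal Laplacian ContDiff
open Literature.Analysis.FluidPDE

namespace Summit.NavierStokesRegularity.NavierStokesRegularity.Theorems.FiveHalvesWindow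

-- the problem directory `NavierStokesRegularity/NavierStokesRegularity` forces the duplicated namespace
set_option linter.dupNamespace false

open Summit.NavierStokesRegularity.NavierStokesRegularity.Theorems.RungReynoldsOne

/-- **A-priori power rates under collapse Reynolds number `C` with a depleted `L^{5/2}` slab coefficient.** GIVEN (i) the sharp `q = 2`
enstrophy slab inequality with time-dependent sup norm (tree:
`Target.Negative.lintegral_frobeniusNormSq_le_exp_half_linfty`), (ii) the weighted
`L^{5/2}`-vorticity slab inequality (stub S3 of the line) and (iii) the Tao-class cover of closed
sub-slabs (stub S5), every classical solution on `ℝ³ × [0,T)`, Leray–Hopf from its rapidly decaying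
datum, with eventual rate `√(T−t)‖u(t,x)‖ ≤ C√ν` (`C > 0`), satisfies for some constants `K₁, K₂, M` and
all `t ∈ (0,T)`: `∫F(curl u(t)) ≤ K₁(T−t)^{-5cC²/2}`, `∫|∇u(t)|² ≤ K₂(T−t)^{-C²/2}`, and
`‖u(t,x)‖² ≤ M/(T−t)` for all `x` (slab coefficient `5c/2` in place of `15/16`; `FiveHalvesWindow.aprioriDecay_of_rate` is `c = 3/8`). -/
theorem aprioriDecay_of_rate_coeff {c : ℝ} (hc0 : 0 ≤ c)
    (hSharp : ∀ ⦃ν T : ℝ⦄, 0 < ν → 0 < T →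
      ∀ ⦃u : ℝ → EuclideanSpace ℝ (Fin 3) → EuclideanSpace ℝ (Fin 3)⦄
        ⦃p : ℝ → EuclideanSpace ℝ (Fin 3) → ℝ⦄,
        IsClassicalNSSolutionOn (Icc 0 T) ν 0 u p →
        HasBoundedSobolevNormsOn (Icc 0 T) u →
        HasBoundedSobolevNormsOn (Icc 0 T) (timeDerivWithin (Icc 0 T) u) →
        (∀ n : ℕ, ∃ C : ℝ≥0, ∀ t ∈ Icc 0 T, ∫⁻ x, ‖iteratedFDeriv ℝ n (p t) x‖ₑ ^ 2 ≤ C) →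
      ∀ ⦃s : ℝ⦄, s ∈ Ioc 0 T →
        (∫⁻ t in Ioo 0 s, ENNReal.ofReal ((eLpNorm (u t) ⊤ volume).toReal ^ (2 : ℝ)) ≠ ⊤) →
        ∫⁻ x, ENNReal.ofReal (frobeniusNormSq (fderiv ℝ (u s) x)) ≤
          ENNReal.ofReal (Real.exp ((2 * ν)⁻¹ *
              (∫⁻ t in Ioo 0 s, ENNReal.ofReal ((eLpNorm (u t) ⊤ volume).toReal ^ (2 : ℝ))).toReal)) *
            ∫⁻ x, ENNReal.ofReal (frobeniusNormSq (fderiv ℝ (u 0) x)))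
    (hA : ∀ ⦃ν T : ℝ⦄, 0 < ν → 0 < T →
      ∀ ⦃u : ℝ → EuclideanSpace ℝ (Fin 3) → EuclideanSpace ℝ (Fin 3)⦄
        ⦃p : ℝ → EuclideanSpace ℝ (Fin 3) → ℝ⦄,
        IsClassicalNSSolutionOn (Icc 0 T) ν 0 u p →
        HasBoundedSobolevNormsOn (Icc 0 T) u →
        HasBoundedSobolevNormsOn (Icc 0 T) (timeDerivWithin (Icc 0 T) u) →
        (∀ n : ℕ, ∃ C : ℝ≥0, ∀ t ∈ Icc 0 T, ∫⁻ x, ‖iteratedFDeriv ℝ n (p t) x‖ₑ ^ 2 ≤ C) →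
      ∀ ⦃s : ℝ⦄, s ∈ Ioc 0 T →
        (∫⁻ t in Ioo 0 s, ENNReal.ofReal ((eLpNorm (u t) ⊤ volume).toReal ^ (2 : ℝ)) ≠ ⊤) →
        ∫⁻ x, ENNReal.ofReal ((‖curl (u s) x‖ ^ 2 + 1) ^ (5 / 4 : ℝ) - 1) ≤
          ENNReal.ofReal (Real.exp (5 * c / (2 * ν) *
              (∫⁻ t in Ioo 0 s, ENNReal.ofReal ((eLpNorm (u t) ⊤ volume).toReal ^ (2 : ℝ))).toReal)) *
            ∫⁻ x, ENNReal.ofReal ((‖curl (u 0) x‖ ^ 2 + 1) ^ (5 / 4 : ℝ) - 1))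
    (hC : ∀ ⦃ν T : ℝ⦄, 0 < ν → 0 < T →
      ∀ ⦃u : ℝ → EuclideanSpace ℝ (Fin 3) → EuclideanSpace ℝ (Fin 3)⦄
        ⦃p : ℝ → EuclideanSpace ℝ (Fin 3) → ℝ⦄,
        IsClassicalNSSolutionOn (Ico 0 T) ν 0 u p → IsLerayHopfOn T ν 0 (u 0) u →
        HasRapidSpatialDecay (u 0) →
      ∀ ⦃T' : ℝ⦄, T' ∈ Ioo 0 T →
        ∃ q : ℝ → EuclideanSpace ℝ (Fin 3) → ℝ,
          IsClassicalNSSolutionOn (Icc 0 T') ν 0 u q ∧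
          HasBoundedSobolevNormsOn (Icc 0 T') u ∧
          HasBoundedSobolevNormsOn (Icc 0 T') (timeDerivWithin (Icc 0 T') u) ∧
          (∀ n : ℕ, ∃ C : ℝ≥0, ∀ t ∈ Icc 0 T', ∫⁻ x, ‖iteratedFDeriv ℝ n (q t) x‖ₑ ^ 2 ≤ C))
    {ν T C : ℝ} (hν : 0 < ν) (hT : 0 < T) (hC0 : 0 < C)
    {u : ℝ → EuclideanSpace ℝ (Fin 3) → EuclideanSpace ℝ (Fin 3)}
    {p : ℝ → EuclideanSpace ℝ (Fin 3) → ℝ}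
    (hsol : IsClassicalNSSolutionOn (Ico 0 T) ν 0 u p) (hLH : IsLerayHopfOn T ν 0 (u 0) u)
    (hdec : HasRapidSpatialDecay (u 0))
    (hrate : ∀ᶠ t in 𝓝[<] T, ∀ x, Real.sqrt (T - t) * ‖u t x‖ ≤ C * Real.sqrt ν) :
    ∃ K₁ K₂ M : ℝ, ∀ t ∈ Ioo 0 T,
      (∫⁻ x, ENNReal.ofReal ((‖curl (u t) x‖ ^ 2 + 1) ^ (5 / 4 : ℝ) - 1) ≤
        ENNReal.ofReal (K₁ * (T - t) ^ (-(5 * c * C ^ 2 / 2)))) ∧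
      (∫⁻ x, ENNReal.ofReal (frobeniusNormSq (fderiv ℝ (u t) x)) ≤
        ENNReal.ofReal (K₂ * (T - t) ^ (-(C ^ 2 / 2)))) ∧
      (∀ x, ‖u t x‖ ^ 2 ≤ M / (T - t)) := by
  -- the rate in the form `√(T−t)‖u‖ ≤ √r`, `r = C²ν`
  set r : ℝ := C ^ 2 * ν with hrdef
  have hr0 : 0 < r := by positivity
  have hCr : C * Real.sqrt ν = Real.sqrt r := by
    rw [hrdef, Real.sqrt_mul' _ hν.le, Real.sqrt_sq hC0.le]
  -- the onset `t₀ ∈ (0, T)` of the rate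
  obtain ⟨a, haT, hsub⟩ := mem_nhdsLT_iff_exists_Ioo_subset.1 hrate
  set t₀ : ℝ := (max a (T / 2) + T) / 2 with ht₀def
  have hmax : max a (T / 2) < T := max_lt haT (by linarith)
  have hat₀ : a < t₀ := by
    have := le_max_left a (T / 2); rw [ht₀def]; linarith
  have ht₀ : t₀ ∈ Ioo 0 T := by
    have := le_max_right a (T / 2); rw [ht₀def]; constructor <;> linarith
  have hrate' : ∀ s ∈ Ico t₀ T, ∀ x, Real.sqrt (T - s) * ‖u s x‖ ≤ Real.sqrt r :=
    fun s hs x => hCr ▸ hsub ⟨hat₀.trans_le hs.1, hs.2⟩ x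
  -- a sup bound on `[0, t₀]` from the Tao cover at `T' = t₀`
  obtain ⟨q₀, hsol₀, hu₀, -, -⟩ := hC hν hT hsol hLH hdec ht₀
  obtain ⟨B₀, hB₀0, hB₀⟩ := exists_forall_norm_le_of_hasBoundedSobolevNormsOn hsol₀ hu₀
  obtain ⟨B₁, hB₁0, hB₁⟩ := exists_forall_norm_fderiv_le_of_hasBoundedSobolevNormsOn
    (fun t ht => (hsol₀.contDiff_velocity ht).of_le (by norm_cast)) hu₀
  obtain ⟨C₁, hC₁⟩ := hu₀ 1
  -- the pointwise bound `‖u s x‖² ≤ M/(T−s)`, `M = B₀²T + r`, on all of `[0, T)`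
  set M : ℝ := B₀ ^ 2 * T + r with hMdef
  have hM0 : 0 ≤ M := by positivity
  have hpt : ∀ s ∈ Ico 0 T, ∀ x, ‖u s x‖ ^ 2 ≤ M / (T - s) := by
    intro s hs x
    have hTs : 0 < T - s := sub_pos.2 hs.2
    rw [le_div_iff₀ hTs]
    by_cases hst : s < t₀
    · have h1 : ‖u s x‖ ^ 2 ≤ B₀ ^ 2 := pow_le_pow_left₀ (norm_nonneg _) (hB₀ s ⟨hs.1, hst.le⟩ x) 2
      have h2 : T - s ≤ T := by linarith [hs.1]
      nlinarith [hr0.le, sq_nonneg B₀]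
    · have h1 := sq_norm_le_of_rate hr0.le hs.2 (hrate' s ⟨not_lt.1 hst, hs.2⟩ x)
      rw [div_eq_mul_inv] at h1
      have h2 : ‖u s x‖ ^ 2 * (T - s) ≤ r := by
        have := mul_le_mul_of_nonneg_right h1 hTs.le
        rwa [mul_assoc, inv_mul_cancel₀ hTs.ne', mul_one] at this
      nlinarith [sq_nonneg B₀, hT]
  -- the sup-norm bound `‖u(s)‖²_∞ ≤ B₀² + r/(T−s)` on `[0, T)`
  have hNsq : ∀ s ∈ Ico 0 T, (eLpNorm (u s) ⊤ volume).toReal ^ (2 : ℝ) ≤ B₀ ^ 2 + r / (T - s) := by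
    intro s hs
    have hTs : 0 < T - s := sub_pos.2 hs.2
    rw [Real.rpow_two]
    by_cases hst : s < t₀
    · have h1 : (eLpNorm (u s) ⊤ volume).toReal ≤ B₀ :=
        toReal_eLpNorm_top_le_of_bound hB₀0 (hB₀ s ⟨hs.1, hst.le⟩)
      have h2 : 0 ≤ r / (T - s) := div_nonneg hr0.le hTs.le
      nlinarith [ENNReal.toReal_nonneg (a := eLpNorm (u s) ⊤ volume)]
    · have hb : 0 ≤ Real.sqrt (r / (T - s)) := Real.sqrt_nonneg _
      have h1 : ∀ x, ‖u s x‖ ≤ Real.sqrt (r / (T - s)) := fun x =>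
        Real.le_sqrt_of_sq_le (sq_norm_le_of_rate hr0.le hs.2 (hrate' s ⟨not_lt.1 hst, hs.2⟩ x))
      have h2 : (eLpNorm (u s) ⊤ volume).toReal ≤ Real.sqrt (r / (T - s)) :=
        toReal_eLpNorm_top_le_of_bound hb h1
      have h3 := pow_le_pow_left₀ ENNReal.toReal_nonneg h2 2
      rw [Real.sq_sqrt (div_nonneg hr0.le hTs.le)] at h3
      nlinarith [sq_nonneg B₀]
  -- the integrated sup-norm bound `Λ(t) ≤ B₀²T + r log(T/(T−t))`
  have hΛ : ∀ t ∈ Ioo 0 T,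
      ∫⁻ s in Ioo 0 t, ENNReal.ofReal ((eLpNorm (u s) ⊤ volume).toReal ^ (2 : ℝ)) ≤
        ENNReal.ofReal (B₀ ^ 2 * T + r * Real.log (T / (T - t))) := by
    intro t ht
    have hTt : 0 < T - t := sub_pos.2 ht.2
    have hlog : 0 ≤ Real.log (T / (T - t)) :=
      Real.log_nonneg ((one_le_div hTt).2 (by linarith [ht.1]))
    calc ∫⁻ s in Ioo 0 t, ENNReal.ofReal ((eLpNorm (u s) ⊤ volume).toReal ^ (2 : ℝ))
        ≤ ∫⁻ s in Ioo 0 t, (ENNReal.ofReal (B₀ ^ 2) + ENNReal.ofReal (r / (T - s))) := by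
          refine setLIntegral_mono' measurableSet_Ioo fun s hs => ?_
          rw [← ENNReal.ofReal_add (sq_nonneg _) (div_nonneg hr0.le (by linarith [hs.2, ht.2]))]
          exact ENNReal.ofReal_le_ofReal (hNsq s ⟨hs.1.le, hs.2.trans ht.2⟩)
      _ = ENNReal.ofReal (B₀ ^ 2) * volume (Ioo 0 t) +
            ∫⁻ s in Ioo 0 t, ENNReal.ofReal (r / (T - s)) := by
          rw [lintegral_add_left measurable_const, setLIntegral_const]
      _ = ENNReal.ofReal (B₀ ^ 2 * t) + ENNReal.ofReal (r * Real.log (T / (T - t))) := by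
          rw [lintegral_Ioo_div_sub_eq hr0.le ht.1.le ht.2, Real.volume_Ioo, sub_zero,
            ← ENNReal.ofReal_mul (sq_nonneg _)]
      _ = ENNReal.ofReal (B₀ ^ 2 * t + r * Real.log (T / (T - t))) :=
          (ENNReal.ofReal_add (mul_nonneg (sq_nonneg _) ht.1.le) (mul_nonneg hr0.le hlog)).symm
      _ ≤ ENNReal.ofReal (B₀ ^ 2 * T + r * Real.log (T / (T - t))) := by
          refine ENNReal.ofReal_le_ofReal ?_
          nlinarith [sq_nonneg B₀, ht.2]
  -- finiteness at time `0`: enstrophy and weighted vorticity mass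
  have h00 : (0 : ℝ) ∈ Icc 0 t₀ := ⟨le_rfl, ht₀.1.le⟩
  have hG0 : ∫⁻ x, ENNReal.ofReal (frobeniusNormSq (fderiv ℝ (u 0) x)) ≤ 3 * C₁ := by
    calc ∫⁻ x, ENNReal.ofReal (frobeniusNormSq (fderiv ℝ (u 0) x))
        ≤ ∫⁻ x, 3 * ‖iteratedFDeriv ℝ 1 (u 0) x‖ₑ ^ 2 := lintegral_mono fun x => by
          rw [← ofReal_norm, norm_iteratedFDeriv_one, ofReal_norm]
          exact ofReal_frobeniusNormSq_le_three_mul_enorm_sq _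
      _ = 3 * ∫⁻ x, ‖iteratedFDeriv ℝ 1 (u 0) x‖ₑ ^ 2 := lintegral_const_mul' _ _ (by norm_num)
      _ ≤ 3 * C₁ := by gcongr; exact hC₁ 0 h00
  have hG0top : ∫⁻ x, ENNReal.ofReal (frobeniusNormSq (fderiv ℝ (u 0) x)) ≠ ⊤ :=
    (hG0.trans_lt (ENNReal.mul_lt_top (by norm_num) ENNReal.coe_lt_top)).ne
  set Bw : ℝ := ‖(curlCLM : (EuclideanSpace ℝ (Fin 3) →L[ℝ] EuclideanSpace ℝ (Fin 3)) →L[ℝ]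
    EuclideanSpace ℝ (Fin 3))‖ * B₁ with hBw
  have hΦ0 : ∫⁻ x, ENNReal.ofReal ((‖curl (u 0) x‖ ^ 2 + 1) ^ (5 / 4 : ℝ) - 1) ≤
      ENNReal.ofReal (5 * (Bw ^ 2 + 1)) * (6 * C₁) := by
    have hwB : ∀ x, ‖curl (u 0) x‖ ≤ Bw := fun x =>
      (norm_curl_le (u 0) x).trans (mul_le_mul_of_nonneg_left (hB₁ 0 h00 x)
        (norm_nonneg (curlCLM : (EuclideanSpace ℝ (Fin 3) →L[ℝ] EuclideanSpace ℝ (Fin 3)) →L[ℝ]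
          EuclideanSpace ℝ (Fin 3))))
    calc ∫⁻ x, ENNReal.ofReal ((‖curl (u 0) x‖ ^ 2 + 1) ^ (5 / 4 : ℝ) - 1)
        ≤ ∫⁻ x, ENNReal.ofReal (5 * (Bw ^ 2 + 1)) * (6 * ‖iteratedFDeriv ℝ 1 (u 0) x‖ₑ ^ 2) := by
          refine lintegral_mono fun x => ?_
          calc ENNReal.ofReal ((‖curl (u 0) x‖ ^ 2 + 1) ^ (5 / 4 : ℝ) - 1)
              ≤ ENNReal.ofReal (5 * (Bw ^ 2 + 1) * ‖curl (u 0) x‖ ^ 2) :=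
                ENNReal.ofReal_le_ofReal (F_le_mul_sq (hwB x))
            _ = ENNReal.ofReal (5 * (Bw ^ 2 + 1)) * ‖curl (u 0) x‖ₑ ^ 2 := by
                rw [ENNReal.ofReal_mul (by positivity), ← ofReal_norm, ENNReal.ofReal_pow (norm_nonneg _)]
            _ ≤ ENNReal.ofReal (5 * (Bw ^ 2 + 1)) * (6 * ‖iteratedFDeriv ℝ 1 (u 0) x‖ₑ ^ 2) := by
                gcongr; exact enorm_curl_sq_le_six_mul (u 0) x
      _ = ENNReal.ofReal (5 * (Bw ^ 2 + 1)) * (6 * ∫⁻ x, ‖iteratedFDeriv ℝ 1 (u 0) x‖ₑ ^ 2) := by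
          rw [lintegral_const_mul' _ _ ENNReal.ofReal_ne_top, lintegral_const_mul' _ _ (by norm_num)]
      _ ≤ ENNReal.ofReal (5 * (Bw ^ 2 + 1)) * (6 * C₁) := by gcongr; exact hC₁ 0 h00
  have hΦ0top : ∫⁻ x, ENNReal.ofReal ((‖curl (u 0) x‖ ^ 2 + 1) ^ (5 / 4 : ℝ) - 1) ≠ ⊤ :=
    (hΦ0.trans_lt (ENNReal.mul_lt_top ENNReal.ofReal_lt_top
      (ENNReal.mul_lt_top (by norm_num) ENNReal.coe_lt_top))).ne
  set G0 : ℝ := (∫⁻ x, ENNReal.ofReal (frobeniusNormSq (fderiv ℝ (u 0) x))).toReal with hG0def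
  set F0 : ℝ := (∫⁻ x, ENNReal.ofReal ((‖curl (u 0) x‖ ^ 2 + 1) ^ (5 / 4 : ℝ) - 1)).toReal
    with hF0def
  have hG0nn : 0 ≤ G0 := ENNReal.toReal_nonneg
  have hF0nn : 0 ≤ F0 := ENNReal.toReal_nonneg
  -- the constants
  set K₁ : ℝ := Real.exp (5 * c / (2 * ν) * (B₀ ^ 2 * T)) * T ^ (5 * c * C ^ 2 / 2) * F0 with hK₁
  set K₂ : ℝ := Real.exp ((2 * ν)⁻¹ * (B₀ ^ 2 * T)) * T ^ (C ^ 2 / 2) * G0 with hK₂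
  refine ⟨K₁, K₂, M, fun t ht => ⟨?_, ?_, hpt t ⟨ht.1.le, ht.2⟩⟩⟩
  · -- the weighted vorticity mass
    obtain ⟨q, hsolt, hut, hutt, hqt⟩ := hC hν hT hsol hLH hdec ht
    have hTt : 0 < T - t := sub_pos.2 ht.2
    have hΛt := hΛ t ht
    have hΛtop : ∫⁻ s in Ioo 0 t, ENNReal.ofReal ((eLpNorm (u s) ⊤ volume).toReal ^ (2 : ℝ)) ≠ ⊤ :=
      (hΛt.trans_lt ENNReal.ofReal_lt_top).ne
    have hmain := hA hν ht.1 hsolt hut hutt hqt ⟨ht.1, le_rfl⟩ hΛtop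
    refine hmain.trans ?_
    have hlog : 0 ≤ Real.log (T / (T - t)) :=
      Real.log_nonneg ((one_le_div hTt).2 (by linarith [ht.1]))
    have hrhs0 : 0 ≤ B₀ ^ 2 * T + r * Real.log (T / (T - t)) := by positivity
    have hexp : Real.exp (5 * c / (2 * ν) *
        (∫⁻ s in Ioo 0 t, ENNReal.ofReal ((eLpNorm (u s) ⊤ volume).toReal ^ (2 : ℝ))).toReal) ≤
        Real.exp (5 * c / (2 * ν) * (B₀ ^ 2 * T)) * (T / (T - t)) ^ (5 * c * C ^ 2 / 2) := by
      have h1 : (∫⁻ s in Ioo 0 t, ENNReal.ofReal ((eLpNorm (u s) ⊤ volume).toReal ^ (2 : ℝ))).toReal ≤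
          B₀ ^ 2 * T + r * Real.log (T / (T - t)) := ENNReal.toReal_le_of_le_ofReal hrhs0 hΛt
      have h2 := Real.exp_le_exp.2 (mul_le_mul_of_nonneg_left h1 (by positivity : (0:ℝ) ≤ 5 * c / (2 * ν)))
      refine h2.trans_eq ?_
      rw [exp_mul_add_mul_log (div_pos hT hTt)]
      congr 2
      rw [hrdef]; field_simp
    have hpow : (T / (T - t)) ^ (5 * c * C ^ 2 / 2) = T ^ (5 * c * C ^ 2 / 2) * (T - t) ^ (-(5 * c * C ^ 2 / 2)) := by
      rw [Real.div_rpow hT.le hTt.le, Real.rpow_neg hTt.le, div_eq_mul_inv]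
    calc ENNReal.ofReal (Real.exp (5 * c / (2 * ν) *
          (∫⁻ s in Ioo 0 t, ENNReal.ofReal ((eLpNorm (u s) ⊤ volume).toReal ^ (2 : ℝ))).toReal)) *
          ∫⁻ x, ENNReal.ofReal ((‖curl (u 0) x‖ ^ 2 + 1) ^ (5 / 4 : ℝ) - 1)
        ≤ ENNReal.ofReal (Real.exp (5 * c / (2 * ν) * (B₀ ^ 2 * T)) * (T / (T - t)) ^ (5 * c * C ^ 2 / 2)) *
            ENNReal.ofReal F0 := by
          rw [ENNReal.ofReal_toReal hΦ0top]
          gcongr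
      _ = ENNReal.ofReal (K₁ * (T - t) ^ (-(5 * c * C ^ 2 / 2))) := by
          rw [← ENNReal.ofReal_mul (by positivity), hpow, hK₁]
          ring_nf
  · -- the enstrophy
    obtain ⟨q, hsolt, hut, hutt, hqt⟩ := hC hν hT hsol hLH hdec ht
    have hTt : 0 < T - t := sub_pos.2 ht.2
    have hΛt := hΛ t ht
    have hΛtop : ∫⁻ s in Ioo 0 t, ENNReal.ofReal ((eLpNorm (u s) ⊤ volume).toReal ^ (2 : ℝ)) ≠ ⊤ :=
      (hΛt.trans_lt ENNReal.ofReal_lt_top).ne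
    have hmain := hSharp hν ht.1 hsolt hut hutt hqt ⟨ht.1, le_rfl⟩ hΛtop
    refine hmain.trans ?_
    have hlog : 0 ≤ Real.log (T / (T - t)) :=
      Real.log_nonneg ((one_le_div hTt).2 (by linarith [ht.1]))
    have hrhs0 : 0 ≤ B₀ ^ 2 * T + r * Real.log (T / (T - t)) := by positivity
    have hexp : Real.exp ((2 * ν)⁻¹ *
        (∫⁻ s in Ioo 0 t, ENNReal.ofReal ((eLpNorm (u s) ⊤ volume).toReal ^ (2 : ℝ))).toReal) ≤
        Real.exp ((2 * ν)⁻¹ * (B₀ ^ 2 * T)) * (T / (T - t)) ^ (C ^ 2 / 2) := by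
      have h1 : (∫⁻ s in Ioo 0 t, ENNReal.ofReal ((eLpNorm (u s) ⊤ volume).toReal ^ (2 : ℝ))).toReal ≤
          B₀ ^ 2 * T + r * Real.log (T / (T - t)) := ENNReal.toReal_le_of_le_ofReal hrhs0 hΛt
      have h2 := Real.exp_le_exp.2 (mul_le_mul_of_nonneg_left h1 (by positivity : (0:ℝ) ≤ (2 * ν)⁻¹))
      refine h2.trans_eq ?_
      rw [exp_mul_add_mul_log (div_pos hT hTt)]
      congr 2
      rw [hrdef]; field_simp
    have hpow : (T / (T - t)) ^ (C ^ 2 / 2) = T ^ (C ^ 2 / 2) * (T - t) ^ (-(C ^ 2 / 2)) := by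
      rw [Real.div_rpow hT.le hTt.le, Real.rpow_neg hTt.le, div_eq_mul_inv]
    calc ENNReal.ofReal (Real.exp ((2 * ν)⁻¹ *
          (∫⁻ s in Ioo 0 t, ENNReal.ofReal ((eLpNorm (u s) ⊤ volume).toReal ^ (2 : ℝ))).toReal)) *
          ∫⁻ x, ENNReal.ofReal (frobeniusNormSq (fderiv ℝ (u 0) x))
        ≤ ENNReal.ofReal (Real.exp ((2 * ν)⁻¹ * (B₀ ^ 2 * T)) * (T / (T - t)) ^ (C ^ 2 / 2)) *
            ENNReal.ofReal G0 := by
          rw [ENNReal.ofReal_toReal hG0top]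
          gcongr
      _ = ENNReal.ofReal (K₂ * (T - t) ^ (-(C ^ 2 / 2))) := by
          rw [← ENNReal.ofReal_mul (by positivity), hpow, hK₂]
          ring_nf



end Summit.NavierStokesRegularity.NavierStokesRegularity.Theorems.FiveHalvesWindow

end
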